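/-
Copyright: the b2b-balaban T⁴-continuum CRUX team, row NE7b leaf lineage `t4-ne7b-formalise-leaf-05` (gen 158). Project licence.
-/
import Mathlib.Analysis.InnerProductSpace.PiL2
import Literature.MathematicalPhysics.QuantumFieldTheory.Balaban1983to89.B6Lemma24Torus

/-!
# [B6] LEMMA 2.4 FOR VECTOR-VALUED BOND FIELDS: the PROVED real Lemma 2.4 — (2.128) p. 245 with the PRINTED constant `1∕(12d²)`
# (`B6Lemma24Printed.lemma24_one`), its torus form p. 249 (`B6Lemma24Torus.lemma24_torus`), and the repaired-constant carrier (`B6Lemma24Assembly.lemma24_kappa0`)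
# — holds VERBATIM for bond fields with values in any finite-dimensional real inner-product space `W` (print's `𝔤 = 𝔲(n)` ∕ `𝔰𝔲(n)` in the Hilbert–Schmidt
# norm [B7] (17)): `(1∕(12d²))·L^{−(d+1)}·Σ_b‖X(b)‖² ≤ L^{d−2}·Σ_c‖(Q₁X)(c)‖² + Σ_p‖(∂₁X)(p)‖²` in the tree (axial) gauge — coordinate by coordinate in an
# orthonormal basis, then Parseval (row NE7b, node U5c; residual (R2′) family (2), letter (ℓ1); the (flat) letter of the (h2) slot BY VALUE for `𝔤`-valued fields at `U = 1`)

Cell `pub-balaban`, sub-cell `t4`, spine estimate NE7b (`T4WeightBudget.RelWeightBound`; the cell's OWN estimate — NOT PRINTED in [Bałaban 1983–89],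
NOT PROVED).  Crux-route work under `Spine/NE7b/`; NOTHING of Bałaban's is asserted beyond what the cited Literature modules PROVE; no `def`; zero `sorry`;
no `T4Continuum/Support` leaf (FREEZE (0)).  Imports: Mathlib `InnerProductSpace.PiL2` (`stdOrthonormalBasis`, `OrthonormalBasis.repr_apply_apply`,
`EuclideanSpace.real_norm_sq_eq`) and `Literature.….Balaban1983to89.B6Lemma24Torus` (hub olean built; it carries `B6Lemma24Printed.lemma24_one` — the real
Lemma 2.4 on `Λ = B(Λ′) ⊂ ℤ^d` with the PRINTED constant —, `B6Lemma24Torus.lemma24_torus` — the same on the torus `T = ℤ^d∕(M₁ℤ × … × M_dℤ)`, p. 249's use-site —,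
`B6Lemma24Assembly.lemma24_kappa0` — the `κ₀(d,L)`-carrier this lineage's `…AdmissibleFloorIMS` §7 reads —, and the dictionaries `B6Lemma24Carrier` (`lamBonds`,
`lamPlaq`, `coarseBonds`, `normSq`, `q1Of`∕`q1Term`, `d1Sq`), `B6Lemma24PrintedShape` (`q1`, `segSum`), `B6Lemma24Torus` (`IsPeriod`, `coarseSites`, `faces`, `bondsT`,
`plaqT`, `normSqT`, `q1SqT`, `d1SqT`), `B6TreeGaugePoincare.curl`, `B6BondElimination` (`unitVec`, `treeBonds`), `B6Elimination.block`).

WHY.  The (h2) slot's per-cube (flat) letter (AFSI §3–§4, AFST §3, AFS2 §3: `c·N′_s Y ≤ F⁰_s Y`) is, at `U = 1`, B9 Sect. E's «Lemma 2.4′» flat half for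
`𝔤`-VALUED fields: `c‖Y‖² ≤ L^{d−2}|Q₁Y|² + |∂₁Y|²` with Hilbert–Schmidt norms.  The tree PROVES Lemma 2.4 for REAL fields (the B6 column: pv09 ∕ b06 lineages)
and this lineage's `…AdmissibleFloorIMS.flat_floor_lemma24` re-reads the `κ₀`-carrier in the `⬝ᵥ` currency for ONE colour component, leaving the component sum to
`floor_of_components` on `m × κ → ℝ`.  THIS FILE states the vector-valued Lemma 2.4 ITSELF, on print's own forms and with print's own constant: the flat curl
`X(z,j) + X(z+e_j,μ) − X(z+e_μ,j) − X(z,μ)` and the flat average `Σ_{x∈B(c₋)} L^{−(d+1)}•Σ_{t<L} X(x+te_μ, μ)` ((2.125)) have REAL scalar coefficients, so every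
coordinate `a ↦ ⟪e_a, X(·)⟫` in an orthonormal basis is a real field with the same support, periodicity and tree gauge, to which the real theorems apply; summing
over `a` is Parseval.

WHAT IS PROVED ([folklore] over the cited theorems; `W` a real inner-product space, `b : OrthonormalBasis κ ℝ W`, `X_a := (b ↦ (b.repr (X b)) a)`):
* §1 coordinates of the B6 forms (Parseval inlined — its named form is AFFC's `normSq_eq_sum_repr_sq`): box carrier — `normSq_coord_sum` (`Σ_a normSq(X_a) = Σ_{b∈lamBonds}‖X b‖²`), `q1Term_coord` ∕ `q1Of_coord_sum`
  (`Σ_a q1Of(X_a) = Σ_{c∈coarseBonds}‖Σ_{x∈B(c₋)}(L⁻¹)^{d+1}•Σ_tX(x+te_μ,μ)‖²`), `curl_coord`, `d1Sq_coord_sum`; torus carrier — `normSqT_coord_sum`, `q1_coord` ∕ `q1SqT_coord_sum`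
  (`Σ_a q1SqT(X_a) = Σ_{c∈faces}‖Σ_{x∈B(c₋)}(L^{d+1})⁻¹•Σ_sX(x+se_μ,μ)‖²`), `d1SqT_coord_sum`; the summation device `floor_of_coord_floors` (a floor for every coordinate
  field, read through three coordinate-sum identities, is the vector floor).
* §2 **`lemma24_one_vector`** — `2 ≤ d`, `1 ≤ L`, `Λ′ ⊂ Lℤ^d`, `W` finite-dimensional; `X : ℤ^d × Fin d → W` vanishing off `lamBonds L Λ′` and on the tree bonds ⊢
  `(1∕(12d²))·L^{−(d+1)}·Σ_{b∈lamBonds}‖X b‖² ≤ L^{d−2}·Σ_{c∈coarseBonds}‖(2.125)-average‖² + Σ_{p∈lamPlaq}‖flat curl‖²` (`lemma24_one` BY NAME per coordinate of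
  `stdOrthonormalBasis ℝ W`); `lemma24_kappa0_vector` — the same with `κ₀(d,L)∕(12d²)` (`lemma24_kappa0`; the constant AFI §7 carries).
* §3 **`lemma24_torus_vector`** — periods `M_i > 0` with `L ∣ M_i`; `X` `M`-periodic (`X(x+v, ν) = X(x, ν)` for `v` in the period lattice) and in the tree gauge on every
  block of `T′` ⊢ `(1∕(12d²))·L^{−(d+1)}·Σ_{b∈bondsT}‖X b‖² ≤ L^{d−2}·Σ_{c∈faces}‖(2.125)-average‖² + Σ_{p∈plaqT}‖flat curl‖²` (`lemma24_torus` BY NAME per coordinate) —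
  the scope of p. 249 («on the whole lattice T^{(k)}»), for `𝔤`-valued fields.
* §4 **`flat_letter_lemma24_vector`** — §2 packaged as the `hflat` binder of AFSI §4 ∕ AFST §3 ∕ AFS2 §3 (`∀ Y, good⁰ Y → c·N′ Y ≤ F⁰ Y`, `good⁰` = support ∧ tree gauge).
* §5 toy: `Λ′ = ∅`, `W = ℝ²` — the box statement elaborates and closes (`example`).

NOT HERE (honest): the transport to the torus cube of the k = 1 instance (the local gauge map `u_s`, (cov)∕(iso)∕(adm): leaf-02 ∕ OWNER), the operator-currency
reading (`…AdmissibleFloorFlatComponents` §4: price `|n|`), which `W` the row adopts (Q-leaf05-g157-1); anything of Bałaban's beyond [B6] Lemma 2.4 as PROVED in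
the tree; (A3) ∕ (A1c); NC-NE7b-α UNRULED.  BY-NAME EFFECT ON THE WALL: NONE (the (flat) letter by value for vector-valued fields; the wall is (R2)).  NE7b NOT
PRINTED ∕ NOT PROVED; spine PROVED 0∕9; rung (B)+1 on ONE finite T⁴ — NOT infinite volume, NOT the mass gap, NOT Clay.
HONEST DEPENDENCY: continuum YM on T⁴ ⇐ BetaPertH ∧ nine spine estimates (0/9 proved); BetaPertH ⇐ (D1) ∧ (D4) ∧ CAP+tail; G-an2-4 gates asym, D1 and NE2/3/4.
-/

set_option autoImplicit false

noncomputable section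

open Finset
open Literature.MathematicalPhysics.QuantumFieldTheory.Balaban1983to89
open Literature.MathematicalPhysics.QuantumFieldTheory.Balaban1983to89.B6LayerPoincare (kappa0)
open Literature.MathematicalPhysics.QuantumFieldTheory.Balaban1983to89.B6BondElimination (unitVec treeBonds)
open Literature.MathematicalPhysics.QuantumFieldTheory.Balaban1983to89.B6Elimination (block)
open Literature.MathematicalPhysics.QuantumFieldTheory.Balaban1983to89.B6TreeGaugePoincare (Cfg curl)
open Literature.MathematicalPhysics.QuantumFieldTheory.Balaban1983to89.B6Lemma24Carrier (lamBonds lamPlaq coarseBonds normSq q1Of q1Term d1Sq)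
open Literature.MathematicalPhysics.QuantumFieldTheory.Balaban1983to89.B6Lemma24Assembly (lemma24_kappa0)
open Literature.MathematicalPhysics.QuantumFieldTheory.Balaban1983to89.B6Lemma24PrintedShape (q1 segSum)
open Literature.MathematicalPhysics.QuantumFieldTheory.Balaban1983to89.B6Lemma24Printed (lemma24_one)
open Literature.MathematicalPhysics.QuantumFieldTheory.Balaban1983to89.B6Lemma24Torus
  (IsPeriod IsPeriodic coarseSites faces bondsT plaqT normSqT q1SqT d1SqT lemma24_torus)

namespace Summit.QuantumFields.BalabanUV.T4Continuum.NE7b.FlatFloorLemma24Vector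

variable {d L : ℕ} {κ W : Type*} [Fintype κ] [NormedAddCommGroup W] [InnerProductSpace ℝ W]

/-! ## §1 The B6 forms of the coordinate fields of a `W`-valued bond field -/

/-- `Σ_a Σ_{b∈S}(X_a b)² = Σ_{b∈S}‖X b‖²` on any finset of bonds (Parseval `‖v‖² = Σ_a (b.repr v a)²` bondwise — Mathlib `EuclideanSpace.real_norm_sq_eq`
through `b.repr.norm_map`, inlined; the named twin is `…AdmissibleFloorFlatComponents.normSq_eq_sum_repr_sq`). [folklore] -/
theorem sum_sq_coord_sum (b : OrthonormalBasis κ ℝ W) (S : Finset ((Fin d → ℤ) × Fin d)) (X : (Fin d → ℤ) × Fin d → W) :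
    ∑ a, ∑ bd ∈ S, b.repr (X bd) a ^ 2 = ∑ bd ∈ S, ‖X bd‖ ^ 2 := by
  rw [Finset.sum_comm]
  exact Finset.sum_congr rfl fun bd _ => by rw [← b.repr.norm_map (X bd), EuclideanSpace.real_norm_sq_eq]

/-- `Σ_a normSq(X_a) = Σ_{b∈lamBonds}‖X b‖²` (box carrier). [folklore] -/
theorem normSq_coord_sum (b : OrthonormalBasis κ ℝ W) (Λ' : Finset (Fin d → ℤ)) (X : (Fin d → ℤ) × Fin d → W) :
    ∑ a, normSq L Λ' (fun bd => b.repr (X bd) a) = ∑ bd ∈ lamBonds L Λ', ‖X bd‖ ^ 2 := by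
  simp only [normSq]
  exact sum_sq_coord_sum b _ X

/-- `Σ_a normSqT(X_a) = Σ_{b∈bondsT}‖X b‖²` (torus carrier). [folklore] -/
theorem normSqT_coord_sum (b : OrthonormalBasis κ ℝ W) (M : Fin d → ℕ) (X : (Fin d → ℤ) × Fin d → W) :
    ∑ a, normSqT M (fun bd => b.repr (X bd) a) = ∑ bd ∈ bondsT M, ‖X bd‖ ^ 2 := by
  simp only [normSqT]
  exact sum_sq_coord_sum b _ X

/-- the (2.125) average term of a coordinate field is the coordinate of the `W`-valued average term, squared (box carrier's `q1Term`). [folklore] -/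
theorem q1Term_coord (b : OrthonormalBasis κ ℝ W) (X : (Fin d → ℤ) × Fin d → W) (a : κ) (c : (Fin d → ℤ) × Fin d) :
    q1Term L (fun bd => b.repr (X bd) a) c =
      b.repr (∑ x ∈ block L c.1, ((L : ℝ)⁻¹) ^ (d + 1) • ∑ t ∈ range L, X (x + (t : ℤ) • unitVec c.2, c.2)) a ^ 2 := by
  simp only [q1Term, OrthonormalBasis.repr_apply_apply, inner_sum, real_inner_smul_right]

/-- `Σ_a q1Of(X_a) = Σ_{c∈coarseBonds}‖Σ_{x∈block L c₋}(L⁻¹)^{d+1}•Σ_{t<L}X(x+te_μ,μ)‖²`. [folklore] -/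
theorem q1Of_coord_sum (b : OrthonormalBasis κ ℝ W) (Λ' : Finset (Fin d → ℤ)) (X : (Fin d → ℤ) × Fin d → W) :
    ∑ a, q1Of L Λ' (fun bd => b.repr (X bd) a) =
      ∑ c ∈ coarseBonds L Λ', ‖∑ x ∈ block L c.1, ((L : ℝ)⁻¹) ^ (d + 1) • ∑ t ∈ range L, X (x + (t : ℤ) • unitVec c.2, c.2)‖ ^ 2 := by
  simp only [q1Of]
  rw [Finset.sum_comm]
  refine Finset.sum_congr rfl fun c _ => ?_
  rw [← b.repr.norm_map, EuclideanSpace.real_norm_sq_eq]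
  exact Finset.sum_congr rfl fun a _ => q1Term_coord b X a c

/-- the verbatim (2.125) average `q1` of a coordinate field is the coordinate of the `W`-valued average (torus carrier's `q1`, via `segSum`). [folklore] -/
theorem q1_coord (b : OrthonormalBasis κ ℝ W) (X : (Fin d → ℤ) × Fin d → W) (a : κ) (c : (Fin d → ℤ) × Fin d) :
    q1 L (fun bd => b.repr (X bd) a) c =
      b.repr (∑ x ∈ block L c.1, ((L : ℝ) ^ (d + 1))⁻¹ • ∑ s ∈ range L, X (x + (s : ℤ) • unitVec c.2, c.2)) a := by
  simp only [q1, segSum, OrthonormalBasis.repr_apply_apply, inner_sum, real_inner_smul_right]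

/-- `Σ_a q1SqT(X_a) = Σ_{c∈faces}‖Σ_{x∈block L c₋}(L^{d+1})⁻¹•Σ_{s<L}X(x+se_μ,μ)‖²`. [folklore] -/
theorem q1SqT_coord_sum (b : OrthonormalBasis κ ℝ W) (M : Fin d → ℕ) (X : (Fin d → ℤ) × Fin d → W) :
    ∑ a, q1SqT L M (fun bd => b.repr (X bd) a) =
      ∑ c ∈ faces L M, ‖∑ x ∈ block L c.1, ((L : ℝ) ^ (d + 1))⁻¹ • ∑ s ∈ range L, X (x + (s : ℤ) • unitVec c.2, c.2)‖ ^ 2 := by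
  simp only [q1SqT]
  rw [Finset.sum_comm]
  refine Finset.sum_congr rfl fun c _ => ?_
  rw [← b.repr.norm_map, EuclideanSpace.real_norm_sq_eq]
  exact Finset.sum_congr rfl fun a _ => by rw [q1_coord]

/-- the flat curl of a coordinate field is the coordinate of the `W`-valued flat curl. [folklore] -/
theorem curl_coord (b : OrthonormalBasis κ ℝ W) (X : (Fin d → ℤ) × Fin d → W) (a : κ) (z : Fin d → ℤ) (j μ : Fin d) :
    curl (fun bd => b.repr (X bd) a) z j μ =
      b.repr (X (z, j) + X (z + unitVec j, μ) - X (z + unitVec μ, j) - X (z, μ)) a := by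
  simp only [curl, OrthonormalBasis.repr_apply_apply, inner_add_right, inner_sub_right]

/-- `Σ_a Σ_{p∈P} curl(X_a)(p)² = Σ_{p∈P}‖flat curl of X at p‖²` on any finset of plaquettes. [folklore] -/
theorem sum_curl_sq_coord_sum (b : OrthonormalBasis κ ℝ W) (P : Finset ((Fin d → ℤ) × Fin d × Fin d)) (X : (Fin d → ℤ) × Fin d → W) :
    ∑ a, ∑ p ∈ P, curl (fun bd => b.repr (X bd) a) p.1 p.2.1 p.2.2 ^ 2 =
      ∑ p ∈ P, ‖X (p.1, p.2.1) + X (p.1 + unitVec p.2.1, p.2.2) - X (p.1 + unitVec p.2.2, p.2.1) - X (p.1, p.2.2)‖ ^ 2 := by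
  rw [Finset.sum_comm]
  refine Finset.sum_congr rfl fun p _ => ?_
  rw [← b.repr.norm_map, EuclideanSpace.real_norm_sq_eq]
  exact Finset.sum_congr rfl fun a _ => by rw [curl_coord]

/-- `Σ_a d1Sq(X_a) = Σ_{p∈lamPlaq}‖flat curl‖²` (box carrier). [folklore] -/
theorem d1Sq_coord_sum (b : OrthonormalBasis κ ℝ W) (Λ' : Finset (Fin d → ℤ)) (X : (Fin d → ℤ) × Fin d → W) :
    ∑ a, d1Sq L Λ' (fun bd => b.repr (X bd) a) =
      ∑ p ∈ lamPlaq L Λ', ‖X (p.1, p.2.1) + X (p.1 + unitVec p.2.1, p.2.2) - X (p.1 + unitVec p.2.2, p.2.1) - X (p.1, p.2.2)‖ ^ 2 := by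
  simp only [d1Sq]
  exact sum_curl_sq_coord_sum b _ X

/-- `Σ_a d1SqT(X_a) = Σ_{p∈plaqT}‖flat curl‖²` (torus carrier). [folklore] -/
theorem d1SqT_coord_sum (b : OrthonormalBasis κ ℝ W) (M : Fin d → ℕ) (X : (Fin d → ℤ) × Fin d → W) :
    ∑ a, d1SqT M (fun bd => b.repr (X bd) a) =
      ∑ p ∈ plaqT M, ‖X (p.1, p.2.1) + X (p.1 + unitVec p.2.1, p.2.2) - X (p.1 + unitVec p.2.2, p.2.1) - X (p.1, p.2.2)‖ ^ 2 := by
  simp only [d1SqT]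
  exact sum_curl_sq_coord_sum b _ X

/-- THE SUMMATION DEVICE: a floor `c·NS(X_a) ≤ w·F1(X_a) + F2(X_a)` for EVERY coordinate field, read through the three coordinate-sum identities
`Σ_a NS(X_a) = NSW`, `Σ_a F1(X_a) = F1W`, `Σ_a F2(X_a) = F2W`, is the vector floor `c·NSW ≤ w·F1W + F2W`. [folklore] -/
theorem floor_of_coord_floors (b : OrthonormalBasis κ ℝ W) (X : (Fin d → ℤ) × Fin d → W) (NS F1 F2 : Cfg d → ℝ)
    {c w NSW F1W F2W : ℝ}
    (hNS : ∑ a, NS (fun bd => b.repr (X bd) a) = NSW) (hF1 : ∑ a, F1 (fun bd => b.repr (X bd) a) = F1W)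
    (hF2 : ∑ a, F2 (fun bd => b.repr (X bd) a) = F2W)
    (hreal : ∀ a, c * NS (fun bd => b.repr (X bd) a) ≤ w * F1 (fun bd => b.repr (X bd) a) + F2 (fun bd => b.repr (X bd) a)) :
    c * NSW ≤ w * F1W + F2W := by
  have hsum := Finset.sum_le_sum fun a (_ : a ∈ (Finset.univ : Finset κ)) => hreal a
  rw [← Finset.mul_sum, Finset.sum_add_distrib, ← Finset.mul_sum, hNS, hF1, hF2] at hsum
  exact hsum

/-! ## §2 Lemma 2.4 on `Λ = B(Λ′) ⊂ ℤ^d` for `W`-valued fields — printed constant, and the `κ₀`-carrier -/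

/-- **[B6] LEMMA 2.4 (2.128) FOR VECTOR-VALUED BOND FIELDS, PRINTED CONSTANT** (`W` any finite-dimensional real inner-product space — `𝔲(n)`, `𝔰𝔲(n)`,
`M_n(ℂ)` in the Hilbert–Schmidt norm): for `2 ≤ d`, `1 ≤ L`, `Λ′ ⊂ Lℤ^d` and `X : ℤ^d × Fin d → W` vanishing off the bonds of `Λ = B(Λ′)` and on the tree-gauge
bonds of every block, `(1∕(12d²))·L^{−(d+1)}·Σ_{b∈Λ}‖X b‖² ≤ L^{d−2}·Σ_c‖(Q₁X)(c)‖² + Σ_p‖(∂₁X)(p)‖²` with print's flat average (2.125) and flat curl —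
`B6Lemma24Printed.lemma24_one` BY NAME on each coordinate field of `stdOrthonormalBasis ℝ W`, summed (§1). [folklore] -/
theorem lemma24_one_vector [FiniteDimensional ℝ W] (hd : 2 ≤ d) (hL : 1 ≤ L) {Λ' : Finset (Fin d → ℤ)}
    (hΛ : ∀ y ∈ Λ', ∀ i, (L : ℤ) ∣ y i) (X : (Fin d → ℤ) × Fin d → W)
    (hX0 : ∀ bd, bd ∉ lamBonds L Λ' → X bd = 0) (hT : ∀ y ∈ Λ', ∀ bd ∈ treeBonds L y, X bd = 0) :
    1 / (12 * (d : ℝ) ^ 2) * (L : ℝ) ^ (-((d : ℝ) + 1)) * ∑ bd ∈ lamBonds L Λ', ‖X bd‖ ^ 2 ≤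
      (L : ℝ) ^ ((d : ℝ) - 2) *
          ∑ c ∈ coarseBonds L Λ', ‖∑ x ∈ block L c.1, ((L : ℝ)⁻¹) ^ (d + 1) • ∑ t ∈ range L, X (x + (t : ℤ) • unitVec c.2, c.2)‖ ^ 2 +
        ∑ p ∈ lamPlaq L Λ', ‖X (p.1, p.2.1) + X (p.1 + unitVec p.2.1, p.2.2) - X (p.1 + unitVec p.2.2, p.2.1) - X (p.1, p.2.2)‖ ^ 2 := by
  set b := stdOrthonormalBasis ℝ W
  refine floor_of_coord_floors b X (normSq L Λ') (q1Of L Λ') (d1Sq L Λ') (normSq_coord_sum b Λ' X) (q1Of_coord_sum b Λ' X)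
    (d1Sq_coord_sum b Λ' X) fun a => ?_
  refine lemma24_one hd hL hΛ _ (fun bd hbd => ?_) (fun y hy bd hbd => ?_)
  · simp only [b, OrthonormalBasis.repr_apply_apply, hX0 bd hbd, inner_zero_right]
  · simp only [b, OrthonormalBasis.repr_apply_apply, hT y hy bd hbd, inner_zero_right]

/-- **THE `κ₀`-CARRIER FOR VECTOR-VALUED FIELDS** (the constant `…AdmissibleFloorIMS.flat_floor_lemma24` carries, `κ₀(d,L)∕(12d²) ≤ 1∕(12d²)`): the same with
`B6Lemma24Assembly.lemma24_kappa0` BY NAME. [folklore] -/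
theorem lemma24_kappa0_vector [FiniteDimensional ℝ W] (hd : 2 ≤ d) (hL : 1 ≤ L) {Λ' : Finset (Fin d → ℤ)}
    (hΛ : ∀ y ∈ Λ', ∀ i, (L : ℤ) ∣ y i) (X : (Fin d → ℤ) × Fin d → W)
    (hX0 : ∀ bd, bd ∉ lamBonds L Λ' → X bd = 0) (hT : ∀ y ∈ Λ', ∀ bd ∈ treeBonds L y, X bd = 0) :
    kappa0 d L / (12 * (d : ℝ) ^ 2) * (L : ℝ) ^ (-((d : ℝ) + 1)) * ∑ bd ∈ lamBonds L Λ', ‖X bd‖ ^ 2 ≤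
      (L : ℝ) ^ ((d : ℝ) - 2) *
          ∑ c ∈ coarseBonds L Λ', ‖∑ x ∈ block L c.1, ((L : ℝ)⁻¹) ^ (d + 1) • ∑ t ∈ range L, X (x + (t : ℤ) • unitVec c.2, c.2)‖ ^ 2 +
        ∑ p ∈ lamPlaq L Λ', ‖X (p.1, p.2.1) + X (p.1 + unitVec p.2.1, p.2.2) - X (p.1 + unitVec p.2.2, p.2.1) - X (p.1, p.2.2)‖ ^ 2 := by
  set b := stdOrthonormalBasis ℝ W
  refine floor_of_coord_floors b X (normSq L Λ') (q1Of L Λ') (d1Sq L Λ') (normSq_coord_sum b Λ' X) (q1Of_coord_sum b Λ' X)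
    (d1Sq_coord_sum b Λ' X) fun a => ?_
  refine lemma24_kappa0 hd hL hΛ _ (fun bd hbd => ?_) (fun y hy bd hbd => ?_)
  · simp only [b, OrthonormalBasis.repr_apply_apply, hX0 bd hbd, inner_zero_right]
  · simp only [b, OrthonormalBasis.repr_apply_apply, hT y hy bd hbd, inner_zero_right]

/-! ## §3 Lemma 2.4 on the torus (the scope of p. 249) for `W`-valued fields -/

/-- **[B6] LEMMA 2.4 ON THE TORUS FOR VECTOR-VALUED BOND FIELDS, PRINTED CONSTANT**: periods `M_i > 0` with `L ∣ M_i`; `X : ℤ^d × Fin d → W` `M`-periodic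
(`X(x + v, ν) = X(x, ν)` for every `v` of the period lattice) and in the tree gauge on every block `B(y)`, `y ∈ T′` ⊢
`(1∕(12d²))·L^{−(d+1)}·Σ_{b∈bondsT}‖X b‖² ≤ L^{d−2}·Σ_{c∈faces}‖Σ_{x∈B(c₋)}(L^{d+1})⁻¹•Σ_{s<L}X(x+se_μ,μ)‖² + Σ_{p∈plaqT}‖(∂₁X)(p)‖²` —
`B6Lemma24Torus.lemma24_torus` BY NAME on each coordinate field (periodicity and tree gauge pass to coordinates), summed (§1). [folklore] -/
theorem lemma24_torus_vector [FiniteDimensional ℝ W] (hd : 2 ≤ d) (hL : 1 ≤ L) {M : Fin d → ℕ} (hM : ∀ i, 0 < M i)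
    (hLM : ∀ i, L ∣ M i) (X : (Fin d → ℤ) × Fin d → W)
    (hX : ∀ (x v : Fin d → ℤ) (ν : Fin d), IsPeriod M v → X (x + v, ν) = X (x, ν))
    (hT : ∀ y ∈ coarseSites L M, ∀ bd ∈ treeBonds L y, X bd = 0) :
    1 / (12 * (d : ℝ) ^ 2) * (L : ℝ) ^ (-((d : ℝ) + 1)) * ∑ bd ∈ bondsT M, ‖X bd‖ ^ 2 ≤
      (L : ℝ) ^ ((d : ℝ) - 2) *
          ∑ c ∈ faces L M, ‖∑ x ∈ block L c.1, ((L : ℝ) ^ (d + 1))⁻¹ • ∑ s ∈ range L, X (x + (s : ℤ) • unitVec c.2, c.2)‖ ^ 2 +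
        ∑ p ∈ plaqT M, ‖X (p.1, p.2.1) + X (p.1 + unitVec p.2.1, p.2.2) - X (p.1 + unitVec p.2.2, p.2.1) - X (p.1, p.2.2)‖ ^ 2 := by
  set b := stdOrthonormalBasis ℝ W
  refine floor_of_coord_floors b X (normSqT M) (q1SqT L M) (d1SqT M) (normSqT_coord_sum b M X) (q1SqT_coord_sum b M X)
    (d1SqT_coord_sum b M X) fun a => ?_
  refine lemma24_torus hd hL hM hLM _ (fun x v ν hv => ?_) (fun y hy bd hbd => ?_)
  · simp only [b, OrthonormalBasis.repr_apply_apply, hX x v ν hv]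
  · simp only [b, OrthonormalBasis.repr_apply_apply, hT y hy bd hbd, inner_zero_right]

/-! ## §4 The (flat) binder shape -/

/-- **THE (flat) BINDER BY VALUE FOR `W`-VALUED FIELDS**: §2 packaged as the `hflat` hypothesis of AFSI §4 ∕ AFST §3 ∕ AFS2 §3 on the cube region
`Λ = B(Λ′)`: `∀ Y, good⁰ Y → c·N′ Y ≤ F⁰ Y` with `good⁰ Y := (Y = 0 off lamBonds) ∧ (Y = 0 on the tree bonds)`, `N′ Y := Σ_{b∈lamBonds}‖Y b‖²`, `F⁰ Y :=`
print's flat form, `c := (1∕(12d²))·L^{−(d+1)}` (printed). [folklore] -/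
theorem flat_letter_lemma24_vector [FiniteDimensional ℝ W] (hd : 2 ≤ d) (hL : 1 ≤ L) {Λ' : Finset (Fin d → ℤ)}
    (hΛ : ∀ y ∈ Λ', ∀ i, (L : ℤ) ∣ y i) :
    ∀ Y : (Fin d → ℤ) × Fin d → W,
      ((∀ bd, bd ∉ lamBonds L Λ' → Y bd = 0) ∧ (∀ y ∈ Λ', ∀ bd ∈ treeBonds L y, Y bd = 0)) →
        1 / (12 * (d : ℝ) ^ 2) * (L : ℝ) ^ (-((d : ℝ) + 1)) * ∑ bd ∈ lamBonds L Λ', ‖Y bd‖ ^ 2 ≤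
          (L : ℝ) ^ ((d : ℝ) - 2) *
              ∑ c ∈ coarseBonds L Λ', ‖∑ x ∈ block L c.1, ((L : ℝ)⁻¹) ^ (d + 1) • ∑ t ∈ range L, Y (x + (t : ℤ) • unitVec c.2, c.2)‖ ^ 2 +
            ∑ p ∈ lamPlaq L Λ', ‖Y (p.1, p.2.1) + Y (p.1 + unitVec p.2.1, p.2.2) - Y (p.1 + unitVec p.2.2, p.2.1) - Y (p.1, p.2.2)‖ ^ 2 :=
  fun Y hY => lemma24_one_vector hd hL hΛ Y hY.1 hY.2

/-! ## §5 Toy: the empty region -/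

/- `Λ′ = ∅`, `W = ℝ²`, `d = 2`, `L = 1`, `X = 0`: every sum is over `∅`-generated finsets of a zero field; the statement elaborates and holds
(casts written as the theorem produces them: `d`, `L` enter through `ℕ`). -/
example : 1 / (12 * ((2 : ℕ) : ℝ) ^ 2) * ((1 : ℕ) : ℝ) ^ (-(((2 : ℕ) : ℝ) + 1)) *
      ∑ bd ∈ lamBonds 1 (∅ : Finset (Fin 2 → ℤ)), ‖(fun _ : (Fin 2 → ℤ) × Fin 2 => (0 : EuclideanSpace ℝ (Fin 2))) bd‖ ^ 2 ≤
    ((1 : ℕ) : ℝ) ^ (((2 : ℕ) : ℝ) - 2) *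
        ∑ c ∈ coarseBonds 1 (∅ : Finset (Fin 2 → ℤ)),
          ‖∑ x ∈ block 1 c.1, (((1 : ℕ) : ℝ)⁻¹) ^ (2 + 1) •
              ∑ t ∈ range 1, (fun _ : (Fin 2 → ℤ) × Fin 2 => (0 : EuclideanSpace ℝ (Fin 2))) (x + (t : ℤ) • unitVec c.2, c.2)‖ ^ 2 +
      ∑ p ∈ lamPlaq 1 (∅ : Finset (Fin 2 → ℤ)),
        ‖(fun _ : (Fin 2 → ℤ) × Fin 2 => (0 : EuclideanSpace ℝ (Fin 2))) (p.1, p.2.1)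
          + (fun _ : (Fin 2 → ℤ) × Fin 2 => (0 : EuclideanSpace ℝ (Fin 2))) (p.1 + unitVec p.2.1, p.2.2)
          - (fun _ : (Fin 2 → ℤ) × Fin 2 => (0 : EuclideanSpace ℝ (Fin 2))) (p.1 + unitVec p.2.2, p.2.1)
          - (fun _ : (Fin 2 → ℤ) × Fin 2 => (0 : EuclideanSpace ℝ (Fin 2))) (p.1, p.2.2)‖ ^ 2 :=
  lemma24_one_vector (W := EuclideanSpace ℝ (Fin 2)) le_rfl le_rfl (Λ' := ∅) (fun _ h => absurd h (Finset.notMem_empty _))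
    (fun _ => 0) (fun _ _ => rfl) (fun _ h => absurd h (Finset.notMem_empty _))

end Summit.QuantumFields.BalabanUV.T4Continuum.NE7b.FlatFloorLemma24Vector

end
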